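/-
Width seat `ym-line-cbag-p1-w3` (prover-ym-line-cbag-p1-w3-g8-0; own items stmt-QuantumFields-22254 `BoxFloorAllGroups` /
stmt-QuantumFields-22893 `ExpChartPackage2` CLOSED proved), helping LINE 3 `route-QuantumFields-SixPlaneColdBox`
(cruxes stmt-QuantumFields-25708 `TorusMeanNearColdBoxG`, stmt-QuantumFields-25709 `DensityTransferG`): the SHARP one-scale kernel-mean
expansion with datum — precision `β^{−1/4}`, every plane `i < j`, every compact group presented in `U(N)`.
-/
import Summits.QuantumFields.YangMills.Theorems.ColdBoxAllGroupsBulkAllGroupsKernelMeanDatumAtBetaG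
import Summits.QuantumFields.YangMills.Theorems.ColdBoxAllGroupsBulkAllGroupsStubKernelMeanExpansionG
import Summits.QuantumFields.YangMills.Theorems.SixPlaneColdBoxKernelMeanSharpGBounds
import Summits.QuantumFields.YangMills.Theorems.WeakCouplingRatesBulkDominatesColdBoxWNearCentreEdges

/-!
# LINE 3 `SixPlaneColdBox`, glue «KernelMeanSharpG», part 2: the one-scale expansion of deep kernel MEANS with a crude-good datum,
# to precision `β^{−1/4}` and in EVERY plane

The interface `KernelMeanExpansionG ρ θ δ` of route `ColdBoxAllGroups` (proved: `stub_kernelMeanExpansionG`, `kernelMeanExpansionG_of_le`)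
states the one-scale expansion of the kernel mean of the `(1,2)`-plaquette cost near the centre of the box `[0,2H]⁴`, `H = ⌈β^θ⌉`, uniformly
over crude-good data `ω`, with the error `β^{−θ}` that crux `BulkAllGroups` consumed.  LINE 3 (`route-QuantumFields-SixPlaneColdBox`, node
`LatticeNonFreezing`, six-plane action density) needs the same expansion (a) in ALL planes `i < j` (temporal ones included) and (b) to precision
`o(β^{−4A})`, `A < θ` — for crux `DensityTransferG` (the datum quadratic form is bounded inside the DLR average by `E_torus|F̄|² ≤ 2·(mean
difference) + error`, so the error must be `o(β^{−4A})` in `β`-units) and for crux `TorusMeanNearColdBoxG` (skeleton stub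
`stub_nestedBoxMeansAgreeG`: flat cold boxes of two sizes have centre means within `β^{−(1+4A+m)}`).  Both are available from the landed
engine: every brick of the datum mean core is plane-generic (`abs_kernelMeanG_sub_gaussian_le_datum` takes `i < j`; the kernel bridge
`integral_plaqCostAt_boxKernelG_eq_of_gauge_trunc_of_near_centre` takes `i ≠ j`), and with the PLAN-v6 parameters the mean core's error sum is
eventually `≤ β^{−1/4}` (`eventually_kernelMean_boundsG_sharp`, part 1).  This file assembles:

* `near_centre_mem_plaquettesTouching_plane` — a plaquette `(x; i<j)` based within `H/8` of the centre touches the box (any plane);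
* `kernelMeanG_sub_interface_le_plane` — p2's `kernelMeanG_sub_interface_le` (the expansion at ONE `β`, one near-centre plaquette, explicit
  error sum) VERBATIM for a general plane `(i,j)`;
* **`kernelMeanSharpG_of_package`** — for a faithful continuous unitary `ρ : G →* U(N)`, `0 < θ ≤ 1/200` and package constants `Ca > 0`, `CE`:
  eventually in `β`, for every crude-good datum `ω` (scale `β^{2θ/5−1}`) and EVERY exponential-chart package `(g, ϑ, s)` of `ω` (charted
  truncated gauge copy, `‖ϑ_e‖ ≤ Ca·β^{3θ+θ/5−1/2}`, forest gauge, Maxwell energy `≤ CE(2H+3)⁴β^{2θ/5−1}`), at every base point `x` within `H/8`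
  of the centre and every plane `i < j`:
  `|β·E_ω[c_{(x;i,j)}] − (D/2)·V_D(x;i,j) − β·Σ_c F̄_c(x;i,j)²| ≤ β^{−1/4}`, `F̄_c` the background of the interface datum `ϑI = (√2)⁻¹•ϑ`
  (the package being explicit, the FLAT datum `ω ≡ 1` can be fed with `ϑ = 0` — part 3);
* **`kernelMeanSharpG`** — the `∃`-packaged form for every compact simple `G` and every `r : LatticeRep G`: `KernelMeanExpansionG r.ρ θ (θ/5)`
  with `β^{−θ}` replaced by `β^{−1/4}` and the plane `(1,2)` by all planes (datum package from `exists_datum_packageG_datVec`).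

No sorry; no new definition; standard axioms.  NOT a claim about the Yang–Mills mass gap: glue for a LINE onto the RECORD-type node
`LatticeNonFreezing` (Chatterjee's Problem 5.1(b) species); the node, the line's cruxes and every summit statement remain open/untouched.
-/

set_option autoImplicit false

noncomputable section

open MeasureTheory ProbabilityTheory Finset Real Filter Topology Metric
open scoped ENNReal Matrix.Norms.Frobenius
open Literature.Probability.LatticeModels (Site glueWith)
open Literature.MathematicalPhysics.QuantumLattice
open Literature.MathematicalPhysics.QuantumFieldTheory
open Literature.MathematicalPhysics.QuantumFieldTheory.LatticeMaxwell
open Literature.MathematicalPhysics.QuantumFieldTheory.AxialGauge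
open Summit.QuantumFields.YangMills.Theorems.WeakCouplingRates
open Summit.QuantumFields.YangMills.Theorems.FreeEnergyLogCoefficient

namespace Summit.QuantumFields.YangMills.Theorems.ColdBoxAllGroups

/-! ## Near-centre plaquettes touch the box, any plane -/

/-- A plaquette `(x; i<j)` based within sup-distance `H/8` of the centre (integer form) touches the cold box `boxEdges 4 (2H+1)` — its edge
`(x, i)` is a box edge (`near_centre_plaquette_edges_mem`, any plane). -/
theorem near_centre_mem_plaquettesTouching_plane {H : ℕ} (hH : 1 ≤ H) {x : Site 4}
    (hx : ∀ m : Fin 4, 8 * |x m - (H : ℤ)| ≤ (H : ℤ)) {i j : Fin 4} (hij : i < j) :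
    ((x, ⟨(i, j), hij⟩) : ZdPlaquette 4) ∈ plaquettesTouching (boxEdges 4 (2 * H + 1)) := by
  obtain ⟨h1, -, -, -⟩ := near_centre_plaquette_edges_mem hH hx (ne_of_lt hij)
  rw [mem_plaquettesTouching_iff]
  exact ⟨(x, i), Finset.mem_inter.2 ⟨by simp [plaquetteEdges], h1⟩⟩

section Box

variable {N : ℕ} {G : Type} [Group G] [TopologicalSpace G] [IsTopologicalGroup G] [CompactSpace G]
  [MeasurableSpace G] [BorelSpace G]
variable (ρ : G →* Matrix (Fin N) (Fin N) ℂ)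

section AtBeta

variable [SecondCountableTopology G]

set_option maxHeartbeats 800000 in
/-- **The one-scale expansion of a deep kernel mean at ONE `β` and one near-centre plaquette IN ANY PLANE `i < j`**, every compact group
presented in `U(N)`: p2's `kernelMeanG_sub_interface_le` verbatim with `(1,2)` replaced by `(i,j)`.  The bound is
`2(2Nβ)pY + (M(e^{2w}−1) + τ + 2(1 + 2D²(R'⁴+3))√P)` with `M = β^{2ε}`, `τ = 190βm³`, `w = 120(2H+1)⁴τ + 4(2H+1)⁴ℓ`, `P = 240D(2H+1)⁴e^{−R²/2}`. -/
theorem kernelMeanG_sub_interface_le_plane (hρc : Continuous ρ) (hinj : Function.Injective ρ)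
    (hρu : ∀ g, ρ g ∈ Matrix.unitaryGroup (Fin N) ℂ)
    {β ε r m ℓ B R R' pY : ℝ} {H : ℕ} (hβ1 : 1 ≤ β) (hH : 1 ≤ H)
    (ω : LGConfig 4 G) (g : Site 4 → G) {ϑ : Fin (dimE ρ) → (Literature.MathematicalPhysics.QuantumLattice.ZdEdge 4 → ℝ)}
    {s : Fin (dimE ρ) → (DirFree H → ℝ)}
    (hWall : ∀ e, forestFix H (glueWith (boxEdgesAt dirCorner (2 * H + 3))
      (fun e' : ↥(boxEdgesAt dirCorner (2 * H + 3)) => gaugeTransformZd g ω e'.1) (fun _ => 1)) e = expChart ρ (datVec ϑ e))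
    (hr0 : 0 ≤ r) (hϑr : ∀ e, ‖datVec ϑ e‖ ≤ r) (hϑ2 : ∀ e, ∑ c, ϑ c e ^ 2 ≤ r ^ 2)
    (hforest : ∀ x : Site 4, (∀ k : Fin 4, 1 ≤ x k ∧ x k + 1 ≤ 2 * (H : ℤ)) → ∀ c, ϑ c (x, 0) = 0)
    (hE : ∑ c, formM (fun e => e ∉ dirFreeEdges H) dirCorner (2 * H + 3) (ϑ c) (s c) ≤ B)
    (hpY : (boxKernelG ρ β H (forestFix H (glueWith (boxEdgesAt dirCorner (2 * H + 3))
      (fun e' : ↥(boxEdgesAt dirCorner (2 * H + 3)) => gaugeTransformZd g ω e'.1) (fun _ => 1)))).real (coldGoodSetG ρ H β ε)ᶜ ≤ pY)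
    (hpY1 : pY < 1)
    (hrm : r ≤ m) (hm4 : m ≤ 1 / 4)
    (hball : ∀ u : G, ‖ρ u - 1‖ ≤ (12 * (H : ℝ) ^ 2 + 2 * H + 1) * (Real.sqrt 2 * Real.sqrt (β ^ (2 * ε - 1)) + 8 * r) →
      u ∈ expChart ρ '' closedBall (0 : EuclideanSpace ℝ (Fin (dimE ρ))) m)
    {J : EuclideanSpace ℝ (Fin (dimE ρ)) → ℝ} (hJm : Measurable J) (hgpos : ∀ a, ‖a‖ ≤ m → 0 < J a) (hℓ0 : 0 ≤ ℓ)
    (hg : ∀ a, ‖a‖ ≤ m → |Real.log (J a)| ≤ ℓ) {c : ℝ≥0∞} (hc0 : c ≠ 0) (hctop : c ≠ ∞)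
    (hdens : (chartMeasureE ρ (1 / 4)).restrict (closedBall 0 m) =
      (c • (volume : Measure (EuclideanSpace ℝ (Fin (dimE ρ)))).restrict (closedBall 0 m)).withDensity (fun a => ENNReal.ofReal (J a)))
    (hR0 : 0 ≤ R) (hR' : Real.sqrt (β * B) + 4 * (Real.sqrt β * r) ≤ R')
    (hmEm : Real.sqrt (dimE ρ) * ((12 * (H : ℝ) ^ 2 + 2 * H + 1) * ((R + R') + 4 * (Real.sqrt β * r))) / Real.sqrt β ≤ m)
    (hwin : (dimE ρ : ℝ) / 2 * (R + R') ^ 2 / β + 190 * m ^ 3 < β ^ (2 * ε - 1))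
    (hP2 : 240 * (dimE ρ : ℝ) * (2 * (H : ℝ) + 1) ^ 4 * Real.exp (-R ^ 2 / 2) ≤ 1 / 2)
    {x : Site 4} (hx : ∀ k : Fin 4, 8 * |x k - (H : ℤ)| ≤ (H : ℤ)) {i j : Fin 4} (hij : i < j) :
    |β * (∫ U, plaqCostAt ρ x i j U ∂(boxKernelG ρ β H ω)) -
        (dimE ρ : ℝ) / 2 * boxDirProjKernel H (x, i, j) (x, i, j) -
        β * ∑ c, sCirc (glue (pin := fun e => e ∉ dirFreeEdges H) dirCorner (2 * H + 3) ((1 / Real.sqrt 2) • ϑ c)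
            (mean (fun e => e ∉ dirFreeEdges H) dirCorner (2 * H + 3) ((1 / Real.sqrt 2) • ϑ c))) (x, i, j) ^ 2| ≤
      2 * (2 * N * β) * pY +
        (β ^ (2 * ε) * (Real.exp (2 * (120 * (2 * (H : ℝ) + 1) ^ 4 * (190 * β * m ^ 3) + 4 * (2 * (H : ℝ) + 1) ^ 4 * ℓ)) - 1) +
          190 * β * m ^ 3 +
          2 * (1 + 2 * (dimE ρ : ℝ) ^ 2 * (R' ^ 4 + 3)) * Real.sqrt (240 * (dimE ρ : ℝ) * (2 * (H : ℝ) + 1) ^ 4 * Real.exp (-R ^ 2 / 2))) := by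
  have hβ0 : 0 < β := by linarith only [hβ1]
  have hR'0 : 0 ≤ R' := le_trans (by positivity) hR'
  have hτ0 : 0 ≤ 190 * β * m ^ 3 := by
    have hm0 : 0 ≤ m := hr0.trans hrm
    positivity
  -- the truncated gauge copy
  set W : LGConfig 4 G := forestFix H (glueWith (boxEdgesAt dirCorner (2 * H + 3))
    (fun e' : ↥(boxEdgesAt dirCorner (2 * H + 3)) => gaugeTransformZd g ω e'.1) (fun _ => 1)) with hWdef
  have hW : ∀ e, e ∉ boxEdges 4 (2 * H + 1) → W e = expChart ρ (datVec ϑ e) := fun e _ => hWall e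
  have hϑ : ∀ e, e ∉ boxEdges 4 (2 * H + 1) → ‖datVec ϑ e‖ ≤ r := fun e _ => hϑr e
  have hϑ2' : ∀ e, e ∉ boxEdges 4 (2 * H + 1) → ∑ c, ϑ c e ^ 2 ≤ r ^ 2 := fun e _ => hϑ2 e
  -- ## the background bound (all plaquettes)
  have hF : ∀ (c : Fin (dimE ρ)) (p : ZdPlaquette 4), |sCirc (glue (pin := fun e => e ∉ dirFreeEdges H) dirCorner (2 * H + 3) (sdatE β ϑ c)
      (mean (fun e => e ∉ dirFreeEdges H) dirCorner (2 * H + 3) (sdatE β ϑ c))) (p.1, p.2.1.1, p.2.1.2)| ≤ R' :=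
    fun c p => (abs_dirBackground_sdatE_le (H := H) hβ0.le hr0 hϑ2' hforest s hE c p).trans hR'
  -- ## the Gaussian window `S` and its real inputs
  set S : Set (TSpaceD H (dimE ρ)) := goodTDE ρ H β ε ϑ ∩
    {t | ∀ e, ‖unscaleTE H (dimE ρ) β (t + meanTE H (dimE ρ) β ϑ) e‖ ≤ m} with hSdef
  have hPS : (gaussD H (dimE ρ)).real Sᶜ ≤ 240 * (dimE ρ : ℝ) * (2 * (H : ℝ) + 1) ^ 4 * Real.exp (-R ^ 2 / 2) :=
    gaussD_real_compl_goodTDE_inter_ball_le ρ hρc hβ0 hH hr0 hR0 hR'0 hϑ hforest hF hmEm hrm hm4 hwin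
  have hcoord : ∀ t ∈ S, ∀ e, ‖extDatum (datVec ϑ) (unscaleTE H (dimE ρ) β (t + meanTE H (dimE ρ) β ϑ)) e‖ ≤ m :=
    fun t ht e => norm_extDatum_le_of_window ρ ϑ _ hr0 hrm hϑ2' ht.2 e
  have hWb : ∀ t ∈ S, |tiltWDE ρ H J β ϑ t| ≤ 120 * (2 * (H : ℝ) + 1) ^ 4 * (190 * β * m ^ 3) + 4 * (2 * (H : ℝ) + 1) ^ 4 * ℓ :=
    fun t ht => (abs_tiltWDE_le ρ hρc hβ0 hm4 hg hforest t (hcoord t ht)).trans (tiltSize_le_cardBound H hτ0 hℓ0)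
  have hxT := near_centre_mem_plaquettesTouching_plane hH hx hij
  have hSur : ∀ t ∈ S, |qObsDE H (dimE ρ) β ϑ (x, i, j) t - β * plaqCostAt ρ x i j (cfgTDE ρ H β ϑ t)| ≤ 190 * β * m ^ 3 :=
    fun t ht => by
    have h := abs_beta_mul_plaqCostAt_sub_qObsDE_le ρ hρc hβ0 hm4 hforest t (hcoord t ht) hxT
    rw [abs_sub_comm] at h
    exact h
  have hFx : ∀ c, |sCirc (glue (pin := fun e => e ∉ dirFreeEdges H) dirCorner (2 * H + 3) (sdatE β ϑ c)
      (mean (fun e => e ∉ dirFreeEdges H) dirCorner (2 * H + 3) (sdatE β ϑ c))) (x, i, j)| ≤ R' := fun c => by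
    have h := hF c ((x, ⟨(i, j), hij⟩) : ZdPlaquette 4)
    exact h
  -- ## the mean core at `W`
  have hcore := abs_kernelMeanG_sub_gaussian_le_datum ρ hρc hinj hρu hJm hβ1 hH hr0 hm4 hW hϑ hball
    hgpos hc0 hctop hdens hpY hpY1 hPS hP2 hWb hij hxT hSur hFx
  -- ## transport of the kernel mean from `ω` to `W`
  rw [integral_plaqCostAt_boxKernelG_eq_of_gauge_trunc_of_near_centre ρ hρc β hH ω g hx (ne_of_lt hij)]
  -- ## units: the core's constant term is the interface's
  have hconst : 1 / 2 * ∑ c, (sCirc (glue (pin := fun e => e ∉ dirFreeEdges H) dirCorner (2 * H + 3) (sdatE β ϑ c)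
        (mean (fun e => e ∉ dirFreeEdges H) dirCorner (2 * H + 3) (sdatE β ϑ c))) (x, i, j)) ^ 2 =
      β * ∑ c, sCirc (glue (pin := fun e => e ∉ dirFreeEdges H) dirCorner (2 * H + 3) ((1 / Real.sqrt 2) • ϑ c)
          (mean (fun e => e ∉ dirFreeEdges H) dirCorner (2 * H + 3) ((1 / Real.sqrt 2) • ϑ c))) (x, i, j) ^ 2 := by
    simp_rw [dirBackground_sdatE_eq]
    rw [half_sum_sq_sqrt_smul_eq hβ0.le, half_beta_sum_dirBackground_sq_eq]
  rw [hconst] at hcore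
  have e : ∀ (X V Fs : ℝ), X - (dimE ρ : ℝ) / 2 * V - Fs = X - ((dimE ρ : ℝ) / 2 * V + Fs) := fun X V Fs => by ring
  rw [e]
  exact hcore

end AtBeta

set_option maxHeartbeats 1600000 in
/-- **The sharp one-scale kernel-mean expansion with an EXPLICIT datum package, every plane.**  For a faithful continuous unitary
`ρ : G →* U(N)` (`N ≥ 1`), `0 < θ ≤ 1/200` and constants `Ca > 0`, `CE` there is `β₀` such that for `β ≥ β₀`, every crude-good datum `ω` (scale
`β^{2(θ/5)−1}`, box `H = ⌈β^θ⌉`), every gauge `g`, chart coordinates `ϑ` and competitors `s` with: the forest-fixed truncated gauge copy of `ω`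
is charted by `ϑ` (`= expChart ρ (datVec ϑ e)` on every edge), `‖datVec ϑ e‖ ≤ Ca·β^{3θ+θ/5−1/2}`, `ϑ` vanishes on the interior temporal
forest, and `Σ_c M_{ϑ c}(s c) ≤ CE(2H+3)⁴β^{2(θ/5)−1}` — at every base point `x` within `H/8` of the centre and every plane `i < j`:
`|β·E_ω[c_{(x;i,j)}] − (D/2)·V_D(x;i,j) − β·Σ_c F̄_c(x;i,j)²| ≤ β^{−1/4}`, `D = dimE ρ`, `V_D = boxDirProjKernel H`, `F̄_c` the Dirichlet
background of the interface datum `(√2)⁻¹•ϑ c`. -/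
theorem kernelMeanSharpG_of_package [NeZero N] (hρc : Continuous ρ) (hinj : Function.Injective ρ)
    (hρu : ∀ g, ρ g ∈ Matrix.unitaryGroup (Fin N) ℂ) {θ : ℝ} (hθ : 0 < θ) (hθ2 : θ ≤ 1 / 200)
    {Ca : ℝ} (hCa : 0 < Ca) (CE : ℝ) :
    ∃ β₀ : ℝ, ∀ β : ℝ, β₀ ≤ β → ∀ (ω : LGConfig 4 G) (g : Site 4 → G)
      (ϑ : Fin (dimE ρ) → (Literature.MathematicalPhysics.QuantumLattice.ZdEdge 4 → ℝ)) (s : Fin (dimE ρ) → (DirFree ⌈β ^ θ⌉₊ → ℝ)),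
      CrudeGoodG ρ β (θ / 5) ⌈β ^ θ⌉₊ ω →
      (∀ e, forestFix ⌈β ^ θ⌉₊ (glueWith (boxEdgesAt dirCorner (2 * ⌈β ^ θ⌉₊ + 3))
        (fun e' : ↥(boxEdgesAt dirCorner (2 * ⌈β ^ θ⌉₊ + 3)) => gaugeTransformZd g ω e'.1) (fun _ => 1)) e = expChart ρ (datVec ϑ e)) →
      (∀ e, ‖datVec ϑ e‖ ≤ Ca * β ^ (3 * θ + θ / 5 - 1 / 2)) →
      (∀ y : Site 4, (∀ k : Fin 4, 1 ≤ y k ∧ y k + 1 ≤ 2 * (⌈β ^ θ⌉₊ : ℤ)) → ∀ c, ϑ c (y, 0) = 0) →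
      (∑ c, formM (fun e => e ∉ dirFreeEdges ⌈β ^ θ⌉₊) dirCorner (2 * ⌈β ^ θ⌉₊ + 3) (ϑ c) (s c) ≤
          CE * (2 * (⌈β ^ θ⌉₊ : ℝ) + 3) ^ 4 * β ^ (2 * (θ / 5) - 1)) →
      ∀ x : Site 4, (∀ k : Fin 4, 8 * |x k - (⌈β ^ θ⌉₊ : ℤ)| ≤ (⌈β ^ θ⌉₊ : ℤ)) → ∀ (i j : Fin 4), i < j →
        |β * (∫ U, plaqCostAt ρ x i j U ∂(boxKernelG ρ β ⌈β ^ θ⌉₊ ω)) -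
            (dimE ρ : ℝ) / 2 * boxDirProjKernel ⌈β ^ θ⌉₊ (x, i, j) (x, i, j) -
            β * ∑ c, sCirc (glue (pin := fun e => e ∉ dirFreeEdges ⌈β ^ θ⌉₊) dirCorner (2 * ⌈β ^ θ⌉₊ + 3) ((1 / Real.sqrt 2) • ϑ c)
                (mean (fun e => e ∉ dirFreeEdges ⌈β ^ θ⌉₊) dirCorner (2 * ⌈β ^ θ⌉₊ + 3) ((1 / Real.sqrt 2) • ϑ c))) (x, i, j) ^ 2| ≤
          β ^ (-(1 / 4 : ℝ)) := by
  haveI : SecondCountableTopology (Matrix (Fin N) (Fin N) ℂ) := inferInstanceAs (SecondCountableTopology (Fin N → Fin N → ℂ))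
  haveI : SecondCountableTopology G := (hρc.isClosedEmbedding hinj).isEmbedding.secondCountableTopology
  have hδ0 : (0 : ℝ) ≤ θ / 5 := by positivity
  have hε : 3 * θ + θ / 5 < 6 * θ := by linarith
  -- structural inputs: the chart density, von Neumann's radius, the YM bad mass at `W`, the sharp numeric bounds
  obtain ⟨r₂, C₂, cH, hr₂, -, hC₂, hcH, J, hJc, hJb, hJhalf, hdens⟩ :=
    exists_chartMeasureE_restrict_closedBall_eq_withDensity ρ hρc hinj hρu
  obtain ⟨η₀, hη₀, hwinη⟩ := linkWindow_subset_image_expChart ρ hρc hinj hρu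
  obtain ⟨β₂, hrare⟩ := boxKernelG_real_coldGoodSetG_compl_le_trunc ρ hρu hρc (θ := θ) (δ := θ / 5) (ε := 6 * θ) hθ hδ0 hε
  obtain ⟨β₃, hnumE⟩ := Filter.eventually_atTop.1
    (eventually_kernelMean_boundsG_sharp N (dimE ρ) (CE := CE) hCa hr₂ hC₂.le hη₀ hθ hθ2)
  refine ⟨max β₂ β₃, fun β hβ ω g ϑ s hω hW hϑr hforest hE x hx i j hij => ?_⟩
  have hb₂ : β₂ ≤ β := (le_max_left _ _).trans hβ
  have hb₃ : β₃ ≤ β := (le_max_right _ _).trans hβ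
  obtain ⟨hβ1, hLη, hm4, hmr₂, hmEm, hrm, hwin, hP2, hfinal⟩ := hnumE β hb₃
  have hβ0 : 0 < β := by linarith
  obtain ⟨hH1r, -⟩ := one_le_ceil_rpow_and_le hβ1 hθ.le
  have hH : 1 ≤ ⌈β ^ θ⌉₊ := by exact_mod_cast hH1r
  -- the YM bad mass at this `β`
  have hpY := hrare β hb₂ ω hω g
  have hpY1 : Real.exp (-(β ^ (6 * θ))) < 1 := by
    rw [Real.exp_lt_one_iff, neg_lt_zero]; exact Real.rpow_pos_of_pos hβ0 _
  -- signs of the bookkeeping quantities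
  have hr0 : (0 : ℝ) ≤ Ca * β ^ (3 * θ + θ / 5 - 1 / 2) := by positivity
  have hR0 : (0 : ℝ) ≤ β ^ (6 * θ) / (4 * (Real.sqrt (dimE ρ) + 1)) := by positivity
  have hmpos : (0 : ℝ) < 2 * ((12 * (⌈β ^ θ⌉₊ : ℝ) ^ 2 + 2 * ⌈β ^ θ⌉₊ + 1) *
      (Real.sqrt 2 * Real.sqrt (β ^ (2 * (6 * θ) - 1)) + 8 * (Ca * β ^ (3 * θ + θ / 5 - 1 / 2)))) := by
    have : 0 < Real.sqrt (β ^ (2 * (6 * θ) - 1)) := Real.sqrt_pos.2 (Real.rpow_pos_of_pos hβ0 _)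
    positivity
  have hℓ0 : (0 : ℝ) ≤ 2 * C₂ * (2 * ((12 * (⌈β ^ θ⌉₊ : ℝ) ^ 2 + 2 * ⌈β ^ θ⌉₊ + 1) *
      (Real.sqrt 2 * Real.sqrt (β ^ (2 * (6 * θ) - 1)) + 8 * (Ca * β ^ (3 * θ + θ / 5 - 1 / 2))))) ^ 2 := by positivity
  have hϑsq : ∀ e, ∑ c, ϑ c e ^ 2 ≤ (Ca * β ^ (3 * θ + θ / 5 - 1 / 2)) ^ 2 := fun e => by
    rw [← norm_datVec_sq]; exact pow_le_pow_left₀ (norm_nonneg _) (hϑr e) 2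
  -- the chart density at radius `m`
  have hgpos : ∀ a : EuclideanSpace ℝ (Fin (dimE ρ)), ‖a‖ ≤ 2 * ((12 * (⌈β ^ θ⌉₊ : ℝ) ^ 2 + 2 * ⌈β ^ θ⌉₊ + 1) *
      (Real.sqrt 2 * Real.sqrt (β ^ (2 * (6 * θ) - 1)) + 8 * (Ca * β ^ (3 * θ + θ / 5 - 1 / 2)))) → 0 < J a := fun a ha => by
    linarith [(hJhalf a (ha.trans hmr₂)).1]
  have hg : ∀ a : EuclideanSpace ℝ (Fin (dimE ρ)), ‖a‖ ≤ 2 * ((12 * (⌈β ^ θ⌉₊ : ℝ) ^ 2 + 2 * ⌈β ^ θ⌉₊ + 1) *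
      (Real.sqrt 2 * Real.sqrt (β ^ (2 * (6 * θ) - 1)) + 8 * (Ca * β ^ (3 * θ + θ / 5 - 1 / 2)))) →
      |Real.log (J a)| ≤ 2 * C₂ * (2 * ((12 * (⌈β ^ θ⌉₊ : ℝ) ^ 2 + 2 * ⌈β ^ θ⌉₊ + 1) *
        (Real.sqrt 2 * Real.sqrt (β ^ (2 * (6 * θ) - 1)) + 8 * (Ca * β ^ (3 * θ + θ / 5 - 1 / 2))))) ^ 2 := fun a ha => by
    refine (abs_log_jacobian_le hJb hJhalf a (ha.trans hmr₂)).trans ?_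
    have : ‖a‖ ^ 2 ≤ (2 * ((12 * (⌈β ^ θ⌉₊ : ℝ) ^ 2 + 2 * ⌈β ^ θ⌉₊ + 1) *
        (Real.sqrt 2 * Real.sqrt (β ^ (2 * (6 * θ) - 1)) + 8 * (Ca * β ^ (3 * θ + θ / 5 - 1 / 2))))) ^ 2 :=
      pow_le_pow_left₀ (norm_nonneg _) ha 2
    nlinarith
  have hc0 : ENNReal.ofReal cH ≠ 0 := by rw [ENNReal.ofReal_ne_zero_iff]; exact hcH
  have hdensm := hdens _ hmpos hmr₂
  -- the link window (`hball`) at radius `m = 2L`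
  have hball : ∀ u : G, ‖ρ u - 1‖ ≤ (12 * (⌈β ^ θ⌉₊ : ℝ) ^ 2 + 2 * ⌈β ^ θ⌉₊ + 1) *
      (Real.sqrt 2 * Real.sqrt (β ^ (2 * (6 * θ) - 1)) + 8 * (Ca * β ^ (3 * θ + θ / 5 - 1 / 2))) →
      u ∈ expChart ρ '' closedBall (0 : EuclideanSpace ℝ (Fin (dimE ρ))) (2 * ((12 * (⌈β ^ θ⌉₊ : ℝ) ^ 2 + 2 * ⌈β ^ θ⌉₊ + 1) *
        (Real.sqrt 2 * Real.sqrt (β ^ (2 * (6 * θ) - 1)) + 8 * (Ca * β ^ (3 * θ + θ / 5 - 1 / 2))))) :=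
    fun u hu => hwinη _ hLη u hu
  -- the expansion at this `β` and this plaquette, then the sharp numeric bound
  have h := kernelMeanG_sub_interface_le_plane ρ hρc hinj hρu (ε := 6 * θ) hβ1 hH ω g hW hr0 hϑr hϑsq hforest hE hpY hpY1 hrm hm4
    hball hJc.measurable hgpos hℓ0 hg hc0 ENNReal.ofReal_ne_top hdensm hR0 le_rfl hmEm hwin hP2 hx hij
  exact h.trans hfinal

end Box

/-! ## The `∃`-packaged form for every compact simple `G` -/

/-- **The sharp kernel-mean expansion with datum, every plane, every compact simple `G`** — `KernelMeanExpansionG r.ρ θ (θ/5)` with the error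
`β^{−θ}` replaced by `β^{−1/4}` and the plane `(1,2)` replaced by all planes `i < j`: for `0 < θ ≤ 1/200` there are `CE, β₀` such that for
`β ≥ β₀` and every crude-good datum `ω` (scale `β^{2(θ/5)−1}`, box `H = ⌈β^θ⌉`) there are one-colour Dirichlet data `ϑ c` and competitors `s c`
of total Maxwell energy `≤ CE(2H+3)⁴β^{2(θ/5)−1}` with, at every base point `x` within `H/8` of the centre and in every plane `i < j`,
`|β·E_ω[c_{(x;i,j)}] − (D/2)·V_D(x;i,j) − β·Σ_c F̄_c(x;i,j)²| ≤ β^{−1/4}`. -/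
theorem kernelMeanSharpG
    (G : Type) [Group G] [TopologicalSpace G] [IsTopologicalGroup G] [CompactSpace G] [MeasurableSpace G] [BorelSpace G]
    (hG : IsCompactSimpleLieGroup G) (r : LatticeRep G) {θ : ℝ} (hθ : 0 < θ) (hθ2 : θ ≤ 1 / 200) :
    ∃ CE : ℝ, ∃ β₀ : ℝ, ∀ β : ℝ, β₀ ≤ β → ∀ ω : LGConfig 4 G, CrudeGoodG r.ρ β (θ / 5) ⌈β ^ θ⌉₊ ω →
      ∃ ϑ : Fin (dimE r.ρ) → (Literature.MathematicalPhysics.QuantumLattice.ZdEdge 4 → ℝ), ∃ s : Fin (dimE r.ρ) → (DirFree ⌈β ^ θ⌉₊ → ℝ),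
        (∑ c, formM (fun e => e ∉ dirFreeEdges ⌈β ^ θ⌉₊) dirCorner (2 * ⌈β ^ θ⌉₊ + 3) (ϑ c) (s c) ≤
            CE * (2 * (⌈β ^ θ⌉₊ : ℝ) + 3) ^ 4 * β ^ (2 * (θ / 5) - 1)) ∧
        ∀ x : Site 4, (∀ m : Fin 4, 8 * |x m - (⌈β ^ θ⌉₊ : ℤ)| ≤ (⌈β ^ θ⌉₊ : ℤ)) → ∀ (i j : Fin 4), i < j →
          |β * (∫ U, plaqCostAt r.ρ x i j U ∂(boxKernelG r.ρ β ⌈β ^ θ⌉₊ ω)) -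
              (dimE r.ρ : ℝ) / 2 * boxDirProjKernel ⌈β ^ θ⌉₊ (x, i, j) (x, i, j) -
              β * ∑ c, sCirc (glue (pin := fun e => e ∉ dirFreeEdges ⌈β ^ θ⌉₊) dirCorner (2 * ⌈β ^ θ⌉₊ + 3)
                (ϑ c) (mean (fun e => e ∉ dirFreeEdges ⌈β ^ θ⌉₊) dirCorner (2 * ⌈β ^ θ⌉₊ + 3) (ϑ c))) (x, i, j) ^ 2| ≤
            β ^ (-(1 / 4 : ℝ)) := by
  haveI : NeZero r.N := ⟨latticeRep_N_ne_zero G hG r⟩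
  have hδ0 : (0 : ℝ) ≤ θ / 5 := by positivity
  have hwin9 : 9 * θ + θ / 5 < 1 / 2 := by linarith
  obtain ⟨Ca, CE, hCa, -, β₁, hpack⟩ :=
    exists_datum_packageG_datVec r.ρ r.continuous r.injective r.mem_unitary (θ := θ) (δ := θ / 5) hθ hδ0 hwin9
  obtain ⟨β₂, hexp⟩ := kernelMeanSharpG_of_package r.ρ r.continuous r.injective r.mem_unitary hθ hθ2 hCa CE
  refine ⟨CE, max β₁ β₂, fun β hβ ω hω => ?_⟩
  have hb₁ : β₁ ≤ β := (le_max_left _ _).trans hβ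
  have hb₂ : β₂ ≤ β := (le_max_right _ _).trans hβ
  obtain ⟨g, ϑ, s, hW, hϑr, -, -, hforest, -, hE⟩ := hpack β hb₁ ω hω
  refine ⟨fun c => (Real.sqrt 2)⁻¹ • ϑ c, fun c => (Real.sqrt 2)⁻¹ • s c, sum_formM_interface_le ϑ s hE, fun x hx i j hij => ?_⟩
  have h := hexp β hb₂ ω g ϑ s hω hW hϑr hforest hE x hx i j hij
  simpa only [one_div] using h

end Summit.QuantumFields.YangMills.Theorems.ColdBoxAllGroups

end
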